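import Summits.CriticalPhenomena.Ising3DConformalLimit.Theorems.MoebiusLimitExists.Negative.MeshContinuity
import Literature.MathematicalPhysics.QuantumFieldTheory.PointwiseOSReconstruction
import Literature.MathematicalPhysics.QuantumFieldTheory.MirrorStencilCauchySchwarz
import Literature.Analysis.FluidPDE.NewtonKernel
import Literature.Analysis.FluidPDE.SecondDifferenceLaplacian
import Literature.Analysis.FluidPDE.HarmonicOfSmallStencil
import HarnessLib

/-!
# Crux `CanonicalDimensionIsWick` (stmt-CriticalPhenomena-15520), line `registered`: STUB A

`stub_planarSymmHarmonic`: for a translation-invariant pointwise lattice limit `S` on `ℝ³`,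
reflection positive along the axis `τ` (pointwise) and Möbius covariant with `Δ = 1/2`, and an
injective triple `Y` in `{x_τ > 0}`, the slot-symmetrised slice
`T_Y(z) = S 4 (Fin.cons z Y) + S 4 (Fin.snoc Y z)` is harmonic on `{x_τ < 0}`.  Discrete OS null
vector: at `Δ = 1/2` the one-point OS entries are `κ(p - θp')`, `κ = A‖·‖⁻¹` harmonic off a small
ball (tree `newtonFar`); the OS matrix is NOT
symmetric (no permutation symmetry) but positivity still gives the discriminant inequality
`rp_cross_sq_le`, whose symmetrised cross entry `K({θp}, Y) + K(Y, {θp})` is `T_Y(p)`; the Gram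
factor of the `7`-point stencil functional is the double stencil of `κ` (`o(h⁴)`, tree
`abs_double_stencil_le_of_laplacian_eq_zero`); continuity by the tree's
`continuousOn_limit_of_translationInvariant`; `harmonicOnNhd_of_abs_stencil_le` concludes.
Refs: Glimm–Jaffe (1987) §6.1 Prop. 6.1.1 [GlimmJaffe1987]; Osterwalder–Schrader (1973) §4.1.
-/

noncomputable section

namespace Summit.CriticalPhenomena.Ising3DConformalLimit.Cruxes.CanonicalDimensionIsWick.Birth

open scoped InnerProductSpace Topology Laplacian
open Filter Set Metric InnerProductSpace
open Literature.Probability.LatticeModels Literature.MathematicalPhysics.QuantumFieldTheory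
open Literature.Analysis.FluidPDE

/-- A coordinate is bounded by the Euclidean norm: `|v τ| ≤ ‖v‖`. [folklore] -/
theorem abs_apply_le_norm₃ (v : EuclideanSpace ℝ (Fin 3)) (τ : Fin 3) : |v τ| ≤ ‖v‖ := by
  rw [EuclideanSpace.norm_eq]
  refine Real.abs_le_sqrt ?_
  have h : ‖v τ‖ ^ 2 ≤ ∑ j, ‖v j‖ ^ 2 :=
    Finset.single_le_sum (f := fun j => ‖v j‖ ^ 2) (fun j _ => sq_nonneg _) (Finset.mem_univ τ)
  simpa only [Real.norm_eq_abs, sq_abs] using h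

/-- The `τ`-coordinate of the axis reflection: `(θ_τ v)_τ = -v_τ`. [folklore] -/
theorem axisReflection_apply_self (τ : Fin 3) (v : EuclideanSpace ℝ (Fin 3)) :
    axisReflection τ v τ = -v τ := by
  rw [axisReflection_apply, if_pos rfl]

/-- Two-point law at the canonical dimension: a Euclidean-invariant family which is scale covariant
with `Δ = 1/2` has `S₂(a,b) = ‖a - b‖⁻¹ · S₂(0, e₀)` for `a ≠ b` (translate, reflect, scale;
Di Francesco–Mathieu–Sénéchal 1997 §4.3.1). [folklore] -/
theorem two_point_law {S : CorrFamily 3} (heuc : IsEuclideanInvariant S)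
    (hsc : IsScaleCovariant (1 / 2 : ℝ) S) {a b : EuclideanSpace ℝ (Fin 3)} (hab : a ≠ b) :
    S 2 ![a, b] = ‖a - b‖⁻¹ * S 2 ![0, EuclideanSpace.single 0 1] := by
  set e : EuclideanSpace ℝ (Fin 3) := EuclideanSpace.single 0 1 with he
  have hne : ‖e‖ = 1 := by simp [he]
  set r : ℝ := ‖b - a‖ with hr
  have hr0 : 0 < r := norm_pos_iff.mpr (sub_ne_zero.mpr (Ne.symm hab))
  have h1 : S 2 ![a, b] = S 2 ![0, b - a] := by
    rw [← heuc.1 2 (-a) ![a, b]]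
    exact congrArg (S 2) (funext fun i => by fin_cases i <;> simp [sub_eq_add_neg])
  have hnorm_eq : ‖b - a‖ = ‖r • e‖ := by
    rw [norm_smul, hne, mul_one, Real.norm_eq_abs, abs_of_pos hr0]
  have hRv : Submodule.reflection (ℝ ∙ ((b - a) - r • e))ᗮ (b - a) = r • e :=
    Submodule.reflection_sub hnorm_eq
  have h2 : S 2 ![0, b - a] = S 2 ![0, r • e] := by
    rw [← heuc.2 2 (Submodule.reflection (ℝ ∙ ((b - a) - r • e))ᗮ) ![0, b - a]]
    exact congrArg (S 2) (funext fun i => by fin_cases i <;> simp [hRv])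
  have h3 : S 2 ![0, r • e] = r⁻¹ * S 2 ![0, e] := by
    have h := hsc 2 r hr0 ![0, e]
    have hfun : (fun i => r • (![0, e] : Fin 2 → EuclideanSpace ℝ (Fin 3)) i) = ![0, r • e] :=
      funext fun i => by fin_cases i <;> simp
    have hexp : r ^ (-((2 : ℕ) : ℝ) * (1 / 2 : ℝ)) = r⁻¹ := by
      rw [show (-((2 : ℕ) : ℝ) * (1 / 2 : ℝ)) = -1 by norm_num, Real.rpow_neg_one]
    rwa [hfun, hexp] at h
  rw [h1, h2, h3, hr, norm_sub_rev]

/-! ### Reflection positivity: arbitrary finite index types, and the discriminant inequality -/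

/-- Pointwise reflection positivity along `τ`, reindexed by an arbitrary finite type. [folklore] -/
theorem rp_sum_nonneg {S : CorrFamily 3} {τ : Fin 3} (hos : IsReflectionPositiveAlong τ S)
    {ι : Type*} [Fintype ι] (a : ι → HalfSpaceConfig 3 τ) (c : ι → ℝ) :
    0 ≤ ∑ i, ∑ j, c i * c j * osPointKernel S (a i) (a j) := by
  classical
  set e := Fintype.equivFin ι with he
  have h := hos (Fintype.card ι) (fun i => a (e.symm i)) (fun i => c (e.symm i))
  calc (0 : ℝ) ≤ _ := h
    _ = ∑ x, ∑ j, c x * c (e.symm j) * osPointKernel S (a x) (a (e.symm j)) :=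
        Equiv.sum_comp e.symm
          (fun x => ∑ j, c x * c (e.symm j) * osPointKernel S (a x) (a (e.symm j)))
    _ = ∑ x, ∑ y, c x * c y * osPointKernel S (a x) (a y) :=
        Finset.sum_congr rfl fun x _ =>
          Equiv.sum_comp e.symm (fun y => c x * c y * osPointKernel S (a x) (a y))

/-- **Discriminant (Cauchy–Schwarz) inequality of a reflection-positive, possibly NON-SYMMETRIC,
OS matrix**: `(Σᵢ uᵢ (K(aᵢ, b) + K(b, aᵢ)))² ≤ 4 (Σᵢⱼ uᵢ uⱼ K(aᵢ, aⱼ)) K(b, b)` (positivity of the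
quadratic form on `(aᵢ; b)` with coefficients `(uᵢ; t)`, all real `t`).
[cite: GlimmJaffe1987, §6.1 Prop. 6.1.1] -/
theorem rp_cross_sq_le {S : CorrFamily 3} {τ : Fin 3} (hos : IsReflectionPositiveAlong τ S)
    {ι : Type*} [Fintype ι] (a : ι → HalfSpaceConfig 3 τ) (u : ι → ℝ) (b : HalfSpaceConfig 3 τ) :
    (∑ i, u i * (osPointKernel S (a i) b + osPointKernel S b (a i))) ^ 2 ≤
      4 * (∑ i, ∑ j, u i * u j * osPointKernel S (a i) (a j)) * osPointKernel S b b := by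
  set B : ℝ := ∑ i, u i * (osPointKernel S (a i) b + osPointKernel S b (a i)) with hB
  set Q : ℝ := ∑ i, ∑ j, u i * u j * osPointKernel S (a i) (a j) with hQ
  set N : ℝ := osPointKernel S b b with hN
  have key : ∀ t : ℝ, 0 ≤ N * (t * t) + B * t + Q := by
    intro t
    have h := rp_sum_nonneg hos (fun o : Option ι => o.elim b a) (fun o => o.elim t u)
    simp only [Fintype.sum_option, Option.elim_none, Option.elim_some] at h
    have e1 : B * t = (∑ j, t * u j * osPointKernel S b (a j)) +
        ∑ i, u i * t * osPointKernel S (a i) b := by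
      rw [hB, Finset.sum_mul, ← Finset.sum_add_distrib]
      exact Finset.sum_congr rfl fun i _ => by ring
    have e2 : (∑ i, (u i * t * osPointKernel S (a i) b +
        ∑ j, u i * u j * osPointKernel S (a i) (a j))) =
        (∑ i, u i * t * osPointKernel S (a i) b) + Q := by
      rw [hQ, ← Finset.sum_add_distrib]
    rw [e2] at h
    nlinarith [h, e1]
  have hd := discrim_le_zero key
  rw [discrim] at hd
  nlinarith [hd]

/-- **STUB A of line `registered` — `stub_planarSymmHarmonic`.** Under the crux hypotheses, for
every axis `τ` and injective triple `Y` in `{x_τ > 0}` the symmetrised slice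
`z ↦ S 4 (Fin.cons z Y) + S 4 (Fin.snoc Y z)` is harmonic on `{x_τ < 0}` (discrete OS null vector of
the harmonic one-point kernel `A‖p - θp'‖⁻¹`; see the module docstring).
[cite: GlimmJaffe1987, §6.1 Prop. 6.1.1] -/
theorem stub_planarSymmHarmonic :
    ∀ S : CorrFamily 3,
      (∃ (G : LatticeCorrFamily 3) (ρ : ℝ → ℝ), HasPointwiseScalingLimit G ρ S) →
      (∀ τ : Fin 3, IsReflectionPositiveAlong τ S) →
      IsNondegenerateTwoPoint S → IsMoebiusCovariant (1 / 2 : ℝ) S →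
      ∀ (τ : Fin 3) (Y : Fin 3 → EuclideanSpace ℝ (Fin 3)), Function.Injective Y →
        (∀ j, 0 < Y j τ) →
        InnerProductSpace.HarmonicOnNhd
          (fun z => S 4 (Fin.cons z Y) + S 4 (Fin.snoc Y z)) {z | z τ < 0} := by
  intro S hlim hos _ hM τ Y hY hYpos
  set θ : EuclideanSpace ℝ (Fin 3) ≃ₗᵢ[ℝ] EuclideanSpace ℝ (Fin 3) := axisReflection τ with hθ
  have hθθ : ∀ v : EuclideanSpace ℝ (Fin 3), θ (θ v) = v := fun v =>
    axisReflection_axisReflection τ v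
  have hθτ : ∀ v : EuclideanSpace ℝ (Fin 3), θ v τ = -v τ := fun v => axisReflection_apply_self τ v
  have htr : IsTranslationInvariant S := hM.isEuclideanInvariant.1
  have hrot : IsRotationInvariant S := hM.isEuclideanInvariant.2
  obtain ⟨f, hf⟩ : ∃ f : EuclideanSpace ℝ (Fin 3) → ℝ,
      ∀ x, f x = S 4 (Fin.cons x Y) + S 4 (Fin.snoc Y x) :=
    ⟨_, fun _ => rfl⟩
  rw [show (fun x : EuclideanSpace ℝ (Fin 3) => S 4 (Fin.cons x Y) + S 4 (Fin.snoc Y x)) = f from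
    funext fun x => (hf x).symm]
  set V : Set (EuclideanSpace ℝ (Fin 3)) := {x | x τ < 0} with hVdef
  have hVo : IsOpen V := isOpen_lt (PiLp.continuous_apply 2 (fun _ => ℝ) τ) continuous_const
  have hxY : ∀ x ∈ V, x ∉ range Y := by
    rintro x hx ⟨j, rfl⟩
    exact lt_asymm (hYpos j) hx
  have hfc : ContinuousOn f V := by
    obtain ⟨G, ρ, hGρ⟩ := hlim
    have hc4 : ContinuousOn (S 4) (NonCoincident 3 4) :=
      LimitMeshContinuity.continuousOn_limit_of_translationInvariant hGρ htr 4
    intro x hx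
    have hx' : x ∉ range Y := hxY x hx
    have hinj : Function.Injective (Fin.cons x Y : Fin 4 → EuclideanSpace ℝ (Fin 3)) :=
      Fin.cons_injective_iff.2 ⟨hx', hY⟩
    have hinj' : Function.Injective (Fin.snoc Y x : Fin 4 → EuclideanSpace ℝ (Fin 3)) :=
      Fin.snoc_injective_iff.2 ⟨hY, hx'⟩
    have hca : ContinuousAt (S 4) (Fin.cons x Y) :=
      hc4.continuousAt ((isOpen_nonCoincident 3 4).mem_nhds hinj)
    have hca' : ContinuousAt (S 4) (Fin.snoc Y x) :=
      hc4.continuousAt ((isOpen_nonCoincident 3 4).mem_nhds hinj')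
    have hcm : Continuous fun x : EuclideanSpace ℝ (Fin 3) =>
        (Fin.cons x Y : Fin 4 → EuclideanSpace ℝ (Fin 3)) :=
      Continuous.finCons (A := fun _ => EuclideanSpace ℝ (Fin 3)) continuous_id continuous_const
    have hcm' : Continuous fun x : EuclideanSpace ℝ (Fin 3) =>
        (Fin.snoc Y x : Fin 4 → EuclideanSpace ℝ (Fin 3)) :=
      Continuous.finSnoc (A := fun _ => EuclideanSpace ℝ (Fin 3)) continuous_const continuous_id
    have h12 := (ContinuousAt.comp (f := fun x => (Fin.cons x Y : Fin 4 → EuclideanSpace ℝ (Fin 3)))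
      (x := x) hca hcm.continuousAt).add (ContinuousAt.comp
        (f := fun x => (Fin.snoc Y x : Fin 4 → EuclideanSpace ℝ (Fin 3))) (x := x) hca'
        hcm'.continuousAt)
    rw [show f = fun x => ((S 4) ∘ fun x => (Fin.cons x Y : Fin 4 → EuclideanSpace ℝ (Fin 3))) x +
        ((S 4) ∘ fun x => (Fin.snoc Y x : Fin 4 → EuclideanSpace ℝ (Fin 3))) x from
      funext fun x => hf x]
    exact h12.continuousWithinAt
  set Yc : HalfSpaceConfig 3 τ := ⟨3, Y, hY, hYpos⟩ with hYc
  set N : ℝ := osPointKernel S Yc Yc with hN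
  have hN0 : 0 ≤ N := by
    have := rp_sum_nonneg (hos τ) (fun _ : Unit => Yc) (fun _ => 1)
    simpa using this
  set A : ℝ := S 2 ![0, EuclideanSpace.single 0 1] with hA
  have h2pt : ∀ a b : EuclideanSpace ℝ (Fin 3), a ≠ b → S 2 ![a, b] = A * ‖a - b‖⁻¹ := by
    intro a b hab
    rw [two_point_law hM.isEuclideanInvariant hM.isScaleCovariant hab, mul_comm]
  set e : OrthonormalBasis (Fin 3) ℝ (EuclideanSpace ℝ (Fin 3)) :=
    EuclideanSpace.basisFun (Fin 3) ℝ with he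
  set e' : OrthonormalBasis (Fin 3) ℝ (EuclideanSpace ℝ (Fin 3)) := e.map θ with he'
  refine harmonicOnNhd_of_abs_stencil_le e hVo hfc fun K hKV hK ε hε => ?_
  rcases K.eq_empty_or_nonempty with hKe | hKne
  · exact ⟨1, one_pos, fun x hx => by simp [hKe] at hx⟩
  obtain ⟨x₀, hx₀K, hmax⟩ := hK.exists_isMaxOn hKne (f := fun x : EuclideanSpace ℝ (Fin 3) => x τ)
    (PiLp.continuous_apply 2 (fun _ => ℝ) τ).continuousOn
  set η : ℝ := -(x₀ τ) with hη
  have hη0 : 0 < η := by have h0 : x₀ τ < 0 := hKV hx₀K; linarith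
  have hKη : ∀ x ∈ K, x τ ≤ -η := fun x hx => by have h0 : x τ ≤ x₀ τ := hmax hx; linarith
  set r₁ : ℝ := η / 2 with hr₁
  have hr₁0 : 0 < r₁ := by positivity
  set κ : EuclideanSpace ℝ (Fin 3) → ℝ := fun z =>
    (-(4 * Real.pi) * A) * newtonFar (r₁ / 2) r₁ z with hκ
  have hNF2 : ContDiff ℝ 2 (newtonFar (r₁ / 2) r₁) :=
    contDiff_newtonFar (half_pos hr₁0) (half_lt_self hr₁0)
  have hκ4 : ContDiff ℝ 4 κ :=
    contDiff_const.mul (contDiff_newtonFar (half_pos hr₁0) (half_lt_self hr₁0))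
  have hUo : IsOpen {z : EuclideanSpace ℝ (Fin 3) | r₁ < ‖z‖} :=
    isOpen_lt continuous_const continuous_norm
  have hκΔ : ∀ z ∈ {z : EuclideanSpace ℝ (Fin 3) | r₁ < ‖z‖}, (Δ κ) z = 0 := by
    intro z hz
    have hsm : κ = (-(4 * Real.pi) * A) • newtonFar (r₁ / 2) r₁ := by
      funext z; simp only [hκ, Pi.smul_apply, smul_eq_mul]
    rw [hsm, InnerProductSpace.laplacian_smul _ hNF2.contDiffAt, smul_eq_mul]
    have h0 := newtonFarLaplacian_eq_zero_of_gt (half_pos hr₁0).le (half_lt_self hr₁0) hz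
    rw [newtonFarLaplacian] at h0
    rw [h0, mul_zero]
  have hκeq : ∀ z : EuclideanSpace ℝ (Fin 3), r₁ ≤ ‖z‖ → κ z = A * ‖z‖⁻¹ := by
    intro z hz
    simp only [hκ]
    rw [newtonFar_eq_newtonKernel (half_pos hr₁0).le (half_lt_self hr₁0) hz, newtonKernel_eq]
    have hz0 : ‖z‖ ≠ 0 := (hr₁0.trans_le hz).ne'
    field_simp
  have hsep : ∀ p p' : EuclideanSpace ℝ (Fin 3), p τ ≤ -(η / 2) → p' τ ≤ -(η / 2) →
      2 * r₁ ≤ ‖p - θ p'‖ := by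
    intro p p' hp hp'
    have h1 : (p - θ p') τ = p τ + p' τ := by
      rw [PiLp.sub_apply, hθτ]; ring
    have h2 : |(p - θ p') τ| ≤ ‖p - θ p'‖ := abs_apply_le_norm₃ _ τ
    rw [h1, abs_of_nonpos (by linarith)] at h2
    rw [hr₁]
    linarith
  set K' : Set (EuclideanSpace ℝ (Fin 3)) := (fun x => x - θ x) '' K with hK'
  have hK'c : IsCompact K' := hK.image (continuous_id.sub θ.continuous)
  have hK'U : K' ⊆ {z : EuclideanSpace ℝ (Fin 3) | r₁ < ‖z‖} := by
    rintro _ ⟨x, hx, rfl⟩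
    have := hsep x x (by linarith [hKη x hx]) (by linarith [hKη x hx])
    show r₁ < ‖x - θ x‖
    linarith
  set ε' : ℝ := ε ^ 2 / (4 * (N + 1)) with hε'
  have hε'0 : 0 < ε' := by positivity
  obtain ⟨h₀, hh₀, hdbl⟩ := abs_double_stencil_le_of_laplacian_eq_zero e' e hκ4 hUo hκΔ hK'c hK'U
    (fun h q => ∑ j, (κ (q + h • e' j) + κ (q - h • e' j) - 2 * κ q)) (fun _ _ => rfl) hε'0
  refine ⟨min h₀ r₁, lt_min hh₀ hr₁0, fun x hx h hh hhm => ?_⟩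
  have hhh₀ : h < h₀ := hhm.trans_le (min_le_left _ _)
  have hhr₁ : h < r₁ := hhm.trans_le (min_le_right _ _)
  have hpt : ∀ s : EuclideanSpace ℝ (Fin 3), ‖s‖ ≤ h → (x + s) τ ≤ -(η / 2) := by
    intro s hs
    rw [PiLp.add_apply]
    have h1 : s τ ≤ ‖s‖ := (le_abs_self _).trans (abs_apply_le_norm₃ s τ)
    have h3 : h ≤ η / 2 := by rw [← hr₁]; exact hhr₁.le
    linarith [hKη x hx]
  have hpos : ∀ s : EuclideanSpace ℝ (Fin 3), ‖s‖ ≤ h → 0 < θ (x + s) τ := fun s hs => by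
    rw [hθτ]; linarith [hpt s hs]
  have hn1 : ∀ i, ‖h • e i‖ ≤ h := fun i => by
    rw [norm_smul, e.orthonormal.1 i, mul_one, Real.norm_eq_abs, abs_of_pos hh]
  have hn1' : ∀ i, ‖-(h • e i)‖ ≤ h := fun i => by rw [norm_neg]; exact hn1 i
  have h00 : ‖(0 : EuclideanSpace ℝ (Fin 3))‖ ≤ h := by rw [norm_zero]; exact hh.le
  have hone : ∀ (s : EuclideanSpace ℝ (Fin 3)) (hs : ‖s‖ ≤ h),
      Function.Injective (fun _ : Fin 1 => θ (x + s)) :=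
    fun s _ => Function.injective_of_subsingleton _
  set P : Fin 3 → HalfSpaceConfig 3 τ := fun i =>
    ⟨1, fun _ => θ (x + h • e i), hone _ (hn1 i), fun _ => hpos _ (hn1 i)⟩ with hP
  set Q : Fin 3 → HalfSpaceConfig 3 τ := fun i =>
    ⟨1, fun _ => θ (x + -(h • e i)), hone _ (hn1' i), fun _ => hpos _ (hn1' i)⟩ with hQ
  set C : HalfSpaceConfig 3 τ := ⟨1, fun _ => θ (x + 0), hone 0 h00, fun _ => hpos 0 h00⟩ with hC
  -- the stencil family, indexed by `(Fin 3 ⊕ Fin 3) ⊕ Unit`, with coefficients `(1, 1, -6)`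
  set a : (Fin 3 ⊕ Fin 3) ⊕ Unit → HalfSpaceConfig 3 τ :=
    Sum.elim (Sum.elim P Q) (fun _ => C) with ha
  set u : (Fin 3 ⊕ Fin 3) ⊕ Unit → ℝ :=
    Sum.elim (Sum.elim (fun _ => (1 : ℝ)) (fun _ => (1 : ℝ))) (fun _ => (-6 : ℝ)) with hu
  have hU : ∀ g : HalfSpaceConfig 3 τ → ℝ,
      ∑ o, u o * g (a o) = ∑ i, (g (P i) + g (Q i) - 2 * g C) := by
    intro g
    rw [Fintype.sum_sum_type, Fintype.sum_sum_type]
    simp only [ha, hu, Sum.elim_inl, Sum.elim_inr, one_mul, Finset.univ_unique,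
      Finset.sum_add_distrib, Finset.sum_sub_distrib, Finset.sum_const, Finset.card_singleton,
      Finset.card_univ, Fintype.card_fin, nsmul_eq_mul, Nat.cast_ofNat, Nat.cast_one]
    ring
  have hcs := rp_cross_sq_le (hos τ) a u Yc
  -- OS matrix entries against `Yc` are values of `f`
  have hKY : ∀ (s : EuclideanSpace ℝ (Fin 3)) (hs : ‖s‖ ≤ h),
      osPointKernel S ⟨1, fun _ => θ (x + s), hone s hs, fun _ => hpos s hs⟩ Yc +
        osPointKernel S Yc ⟨1, fun _ => θ (x + s), hone s hs, fun _ => hpos s hs⟩ = f (x + s) := by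
    intro s hs
    have e1 : osPointKernel S ⟨1, fun _ => θ (x + s), hone s hs, fun _ => hpos s hs⟩ Yc =
        S 4 (Fin.cons (x + s) Y) := by
      show S 4 (Fin.append (fun _ : Fin 1 => θ (θ (x + s))) Y) = S 4 (Fin.cons (x + s) Y)
      rw [hθθ]
      congr 1
      funext i
      fin_cases i <;> rfl
    have e2 : osPointKernel S Yc ⟨1, fun _ => θ (x + s), hone s hs, fun _ => hpos s hs⟩ =
        S 4 (Fin.snoc Y (x + s)) := by
      show S 4 (Fin.append (fun i => θ (Y i)) (fun _ : Fin 1 => θ (x + s))) =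
        S 4 (Fin.snoc Y (x + s))
      have h := hrot 4 θ (Fin.snoc Y (x + s))
      rw [← h]
      congr 1
      funext i
      fin_cases i <;> simp [Fin.snoc, Fin.append, Fin.addCases]
    rw [e1, e2, hf]
  -- OS matrix entries between one-point configurations are values of `κ`
  have hKK : ∀ (s s' : EuclideanSpace ℝ (Fin 3)) (hs : ‖s‖ ≤ h) (hs' : ‖s'‖ ≤ h),
      osPointKernel S ⟨1, fun _ => θ (x + s), hone s hs, fun _ => hpos s hs⟩
        ⟨1, fun _ => θ (x + s'), hone s' hs', fun _ => hpos s' hs'⟩ = κ ((x - θ x - θ s') + s) := by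
    intro s s' hs hs'
    show S (1 + 1) (Fin.append (fun _ : Fin 1 => θ (θ (x + s))) (fun _ : Fin 1 => θ (x + s'))) = _
    rw [corrFamily_append_one_one S]
    have hd : 2 * r₁ ≤ ‖(x + s) - θ (x + s')‖ := hsep _ _ (hpt s hs) (hpt s' hs')
    have hne : x + s ≠ θ (x + s') := fun h' => by
      rw [h', sub_self, norm_zero] at hd; linarith
    have harg : x - θ x - θ s' + s = (x + s) - θ (x + s') := by rw [map_add]; abel
    rw [hθθ, h2pt _ _ hne, harg, hκeq ((x + s) - θ (x + s')) (by linarith)]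
  -- the left-hand side of `hcs` is the stencil of `f` at `x`
  have lhs_eq : ∑ o, u o * (osPointKernel S (a o) Yc + osPointKernel S Yc (a o)) =
      ∑ i, (f (x + h • e i) + f (x - h • e i) - 2 * f x) := by
    rw [hU (fun D => osPointKernel S D Yc + osPointKernel S Yc D)]
    refine Finset.sum_congr rfl fun i _ => ?_
    rw [hP, hQ, hC]
    simp only
    rw [hKY (h • e i) (hn1 i), hKY (-(h • e i)) (hn1' i), hKY 0 h00, add_zero, ← sub_eq_add_neg]
  -- the Gram factor of `hcs` is the double stencil of `κ` at `x - θ x`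
  have rhs_eq : ∑ o, ∑ o', u o * u o' * osPointKernel S (a o) (a o') =
      ∑ i, ((∑ j, (κ ((x - θ x + h • e i) + h • e' j) + κ ((x - θ x + h • e i) - h • e' j) -
                2 * κ (x - θ x + h • e i))) +
            (∑ j, (κ ((x - θ x - h • e i) + h • e' j) + κ ((x - θ x - h • e i) - h • e' j) -
                2 * κ (x - θ x - h • e i))) -
            2 * (∑ j, (κ ((x - θ x) + h • e' j) + κ ((x - θ x) - h • e' j) -
              2 * κ (x - θ x)))) := by
    have step1 : ∑ o, ∑ o', u o * u o' * osPointKernel S (a o) (a o') =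
        ∑ o, u o * (∑ j, (osPointKernel S (a o) (P j) + osPointKernel S (a o) (Q j) -
          2 * osPointKernel S (a o) C)) := by
      refine Finset.sum_congr rfl fun o _ => ?_
      rw [← hU (fun D => osPointKernel S (a o) D), Finset.mul_sum]
      exact Finset.sum_congr rfl fun o' _ => by ring
    rw [step1, hU (fun D => ∑ j, (osPointKernel S D (P j) + osPointKernel S D (Q j) -
      2 * osPointKernel S D C))]
    have e'j : ∀ j, e' j = θ (e j) := fun j => by rw [he', OrthonormalBasis.map_apply]
    refine Finset.sum_congr rfl fun i _ => ?_
    have A1 : ∑ j, (osPointKernel S (P i) (P j) + osPointKernel S (P i) (Q j) -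
        2 * osPointKernel S (P i) C) =
        ∑ j, (κ ((x - θ x + h • e i) - h • e' j) + κ ((x - θ x + h • e i) + h • e' j) -
          2 * κ (x - θ x + h • e i)) := by
      refine Finset.sum_congr rfl fun j _ => ?_
      rw [hP, hQ, hC]
      simp only
      rw [hKK (h • e i) (h • e j) (hn1 i) (hn1 j), hKK (h • e i) (-(h • e j)) (hn1 i) (hn1' j),
        hKK (h • e i) 0 (hn1 i) h00, map_neg, map_smul, map_zero, ← e'j]
      congr 2 <;> [congr 1; congr 1; congr 2] <;> abel
    have A2 : ∑ j, (osPointKernel S (Q i) (P j) + osPointKernel S (Q i) (Q j) -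
        2 * osPointKernel S (Q i) C) =
        ∑ j, (κ ((x - θ x - h • e i) - h • e' j) + κ ((x - θ x - h • e i) + h • e' j) -
          2 * κ (x - θ x - h • e i)) := by
      refine Finset.sum_congr rfl fun j _ => ?_
      rw [hP, hQ, hC]
      simp only
      rw [hKK (-(h • e i)) (h • e j) (hn1' i) (hn1 j),
        hKK (-(h • e i)) (-(h • e j)) (hn1' i) (hn1' j),
        hKK (-(h • e i)) 0 (hn1' i) h00, map_neg, map_smul, map_zero, ← e'j]
      congr 2 <;> [congr 1; congr 1; congr 2] <;> abel
    have A3 : ∑ j, (osPointKernel S C (P j) + osPointKernel S C (Q j) - 2 * osPointKernel S C C) =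
        ∑ j, (κ ((x - θ x) - h • e' j) + κ ((x - θ x) + h • e' j) - 2 * κ (x - θ x)) := by
      refine Finset.sum_congr rfl fun j _ => ?_
      rw [hP, hQ, hC]
      simp only
      rw [hKK 0 (h • e j) h00 (hn1 j), hKK 0 (-(h • e j)) h00 (hn1' j), hKK 0 0 h00 h00, map_neg,
        map_smul, map_zero, ← e'j]
      congr 2 <;> [congr 1; congr 1; congr 2] <;> abel
    rw [A1, A2, A3]
    have swap : ∀ (q : EuclideanSpace ℝ (Fin 3)),
        ∑ j, (κ (q - h • e' j) + κ (q + h • e' j) - 2 * κ q) =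
        ∑ j, (κ (q + h • e' j) + κ (q - h • e' j) - 2 * κ q) :=
      fun q => Finset.sum_congr rfl fun j _ => by ring
    rw [swap, swap, swap]
  have hd := hdbl _ ⟨x, hx, rfl⟩ h hh hhh₀
  have hsq : (∑ i, (f (x + h • e i) + f (x - h • e i) - 2 * f x)) ^ 2 ≤ (ε * h ^ 2) ^ 2 := by
    rw [← lhs_eq]
    refine hcs.trans ?_
    rw [rhs_eq]
    calc 4 * _ * N ≤ 4 * (ε' * h ^ 4) * N := by
          refine mul_le_mul_of_nonneg_right ?_ hN0
          exact mul_le_mul_of_nonneg_left ((le_abs_self _).trans hd) (by norm_num)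
      _ ≤ (ε * h ^ 2) ^ 2 := by
          rw [hε']
          have : ε ^ 2 / (4 * (N + 1)) * N ≤ ε ^ 2 / 4 := by
            rw [div_mul_eq_mul_div, div_le_div_iff₀ (by positivity) (by positivity)]
            nlinarith [sq_nonneg ε]
          nlinarith [pow_nonneg hh.le 4]
  exact abs_le_of_sq_le_sq hsq (by positivity)

end Summit.CriticalPhenomena.Ising3DConformalLimit.Cruxes.CanonicalDimensionIsWick.Birth

end
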